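import Summits.HubbardSuperconductivity.HubbardSuperconductivity.Theses.AnisotropyChord
import Summits.HubbardSuperconductivity.HubbardSuperconductivity.Theorems.AnisotropyChordChordToOrderXY

/-!
# Route `AnisotropyChord`: the split glue `ChordFMOfPieces` (stmt-HubbardSuperconductivity-19090)

Notation: `H_M(Δ) = xxzHamiltonian 1 (torusGraph 2 M) (−1) Δ` (spin-½ XXZ torus, `M` even),
`Λ(ψ) = Re⟨ψ, S⁺_tot S⁻_tot ψ⟩`, `S = M²/2` (exact ferromagnetic value `Λ_M(1) = S(S+1)`).

* `chordFMOfPieces_proof : ChordFMOfPieces` (`ChordXY → FerroSideChord → ChordFM`), the typed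
  decomposition of the Tier-B chord (crux-strategist, 2026-08-17): for `Δ ≥ 0` the FM-side chord
  verbatim; for `Δ < 0` the FM-side chord AT the KLS point `Δ = 0`, evaluated at an existing
  normalised sector ground state `ψ₀` of `H_M(0)` (`exists_unit_sectorGroundState_xy`), is the
  reflection-positivity-free anchor `S(S+1)/2 ≤ Λ(ψ₀)`, which `ChordXY` transports:
  `((1+Δ)/2)·S(S+1) = (1+Δ)·(S(S+1)/2) ≤ (1+Δ)Λ(ψ₀) ≤ Λ(ψ)`.

The same 17-line argument is the composition `ChordFM_of` of the crux line
`Cruxes/ChordFM/Lines/split_chordxy_ferroside.lean` and the candidate proofs attached to the item by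
the strategist and a refuter; landed here under `Theorems/` so the item closes.
Sources: the route card (idea `anisotropy-chord-xxz`); Kennedy–Lieb–Shastry, PRL 61 (1988) 2582;
B. Tóth, J. Stat. Phys. 65 (1991) 373. No definition is introduced.
-/

set_option linter.dupNamespace false

noncomputable section

namespace Summit.HubbardSuperconductivity.HubbardSuperconductivity.Theorems.AnisotropyChord

open Matrix Literature.MathematicalPhysics.QuantumLattice Literature.Probability.LatticeModels
open Summit.HubbardSuperconductivity.HubbardSuperconductivity.Theses.AnisotropyChord

/-- **`ChordFMOfPieces` holds** (route `AnisotropyChord`, item `stmt-HubbardSuperconductivity-19090`):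
`ChordXY → FerroSideChord → ChordFM`. Case split at the KLS point: on the ferromagnetic side
`Δ ∈ [0,1]` the FM-side chord is `ChordFM` verbatim; on `Δ ∈ [-1,0)` the FM-side chord at `Δ = 0`
on a normalised sector ground state `ψ₀` of `H_M(0)` gives `S(S+1)/2 ≤ Λ(ψ₀)` and `ChordXY` gives
`(1+Δ)Λ(ψ₀) ≤ Λ(ψ)`. [folklore] -/
theorem chordFMOfPieces_proof : ChordFMOfPieces := by
  unfold ChordFMOfPieces
  intro hXY hF M _ hE h4 Δ hΔ ψ hmem hψ1 heig
  by_cases hΔ0 : 0 ≤ Δ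
  · -- ferromagnetic side `Δ ∈ [0,1]`: the FM-side chord verbatim
    exact hF M hE h4 Δ ⟨hΔ0, hΔ.2⟩ ψ hmem hψ1 heig
  · -- antiferromagnetic side `Δ ∈ [-1,0)`: RP-free anchor at the KLS point, transported by ChordXY
    obtain ⟨ψ₀, hmem₀, hψ₀1, heig₀⟩ :=
      exists_unit_sectorGroundState_xy M hE (le_trans (by norm_num) h4)
    have hA := hF M hE h4 0 ⟨le_rfl, by norm_num⟩ ψ₀ hmem₀ hψ₀1 heig₀
    have hC := hXY M hE h4 Δ ⟨hΔ.1, (not_le.mp hΔ0).le⟩ ψ₀ ψ hmem₀ hψ₀1 heig₀ hmem hψ1 heig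
    have h1 : 0 ≤ 1 + Δ := by linarith [hΔ.1]
    calc (1 + Δ) / 2 * ((M : ℝ) ^ 2 / 2 * ((M : ℝ) ^ 2 / 2 + 1))
        = (1 + Δ) * ((1 + 0) / 2 * ((M : ℝ) ^ 2 / 2 * ((M : ℝ) ^ 2 / 2 + 1))) := by ring
      _ ≤ (1 + Δ) * (star ψ₀ ⬝ᵥ Matrix.mulVec ((∑ x : TorusSite 2 M, onSite x (spinRaise 1)) *
            (∑ y : TorusSite 2 M, onSite y (spinLower 1))) ψ₀).re :=
          mul_le_mul_of_nonneg_left hA h1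
      _ ≤ _ := hC

end Summit.HubbardSuperconductivity.HubbardSuperconductivity.Theorems.AnisotropyChord
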